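import Literature.Computability.Complexity.MachinPiFP
import Literature.Computability.Complexity.CodeFPBudgets
import Mathlib.Analysis.SpecialFunctions.Log.Deriv
import Mathlib.Analysis.SpecificLimits.Basic
import HarnessLib

/-!
# Logarithms of rationals to any dyadic precision in polynomial time

Topic `Computability/Complexity`, toolkit above the typed polynomial-time algebra `CodeFP`
(`CodeFP.lean`, `CodeFPArith.lean`, `CodeFPRat.lean`, `MachinPiFP.lean`: exact rational arithmetic,
`ratSum`, `natPow` with unary exponents, `ratRound`). Everything here is proved; definitions have
bodies; no named fact is introduced.

Hallgren's algorithm for the regulator (Jozsa 2003, §9 Thm. 5: "we also carry along a parallel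
computation of their accumulating distances … calculating to a sufficient accuracy") adds up Shanks
distances `ln γ`, `γ = (b + √D)/2a`, and giant-step defects `ln |θ'/S|`, all logarithms of explicit
algebraic numbers, to precision `2⁻ᵖ` for a `p` polynomial in `log D`
(`Cryptography/InfrastructureNavigation.lean`: the evaluators `ghat`, `khat` of a `GiantStepCycle`).
With `√D` replaced by `⌊2ʲ√D⌋/2ʲ` these are logarithms of RATIONALS; this file provides them:

* `artanhTermQ u v k = u^{2k+1}/((2k+1) v^{2k+1})`, `artanhSum u v K = ∑_{k<K} artanhTermQ u v k`
  (`∈ ℚ`) and **`abs_log_sub_two_mul_artanhSum_le`**: for `3u ≤ v`,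
  `|log ((v+u)/(v−u)) − 2 artanhSum u v K| ≤ (1/9)ᴷ` (Mathlib's
  `Real.hasSum_log_sub_log_of_abs_lt_one`, the series `log(1+x) − log(1−x) = ∑ 2x^{2k+1}/(2k+1)`,
  `x = u/v ≤ 1/3`, tail against the geometric series);
* `ln2Q K = 2 artanhSum 1 3 K` (`log 2 = log ((3+1)/(3−1))`), `abs_log_two_sub_ln2Q_le`;
* argument reduction `logShift a b = ⌊log₂ ⌊a/b⌋⌋` (`b 2ˢ ≤ a < b 2^{s+1}`, `logShift_spec`) and
  `lnQ a b K = s · ln2Q K + 2 artanhSum (a − b2ˢ) (a + b2ˢ) K`, **`abs_log_div_sub_lnQ_le`**: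
  `|log (a/b) − lnQ a b K| ≤ (s + 1)/9ᴷ` for `1 ≤ b ≤ a`;
* the dyadic name `lnDyadic a b p = round (2ᵖ lnQ a b (p + |a|₂ + 1))`, **`abs_log_div_sub_lnDyadic_le`**:
  `|log (a/b) − lnDyadic a b p / 2ᵖ| ≤ 2⁻ᵖ` (`1 ≤ b ≤ a`), and its signed extension `lnDyadicZ`
  (`a, b ≥ 1` in either order, `abs_log_div_sub_lnDyadicZ_le`);
* `lnQuadDyadic P Q D j p` — `log ((P + √D)/Q)` (a Shanks distance `ln γ`) to `p` bits with `√D`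
  read to `j` bits through `⌊2ʲ√D⌋ = Nat.sqrt (D 4ʲ)`, **`abs_log_quad_sub_lnQuadDyadic_le`**
  (error `≤ 2⁻ᵖ + 2⁻ʲ`), `codeFP_lnQuadDyadic`;
* **polynomial time**: `codeFP_artanhSum` (`(u, v, 1ᴷ) ↦ encodeRat (artanhSum u v K)`),
  `codeFP_lnQ`, **`codeFP_lnDyadic`** (`(bin a, bin b, 1ᵖ) ↦ intE (lnDyadic a b p)`),
  `codeFP_lnDyadicZ` — assembled from the `CodeFP` combinators exactly as `MachinPiFP.lean` does for
  `π` (a bounded `map` of the terms over `[0, K)`, each a lowest-terms fraction by `natPow` with unary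
  exponents, then `ratSum`, `ratRound`); the shift `s ≤ |a|₂` is computed by `natLog2Min` and used as a
  unary exponent.

## References

* R. Jozsa, *Notes on Hallgren's efficient quantum algorithm for solving Pell's equation*,
  arXiv:quant-ph/0302134 (2003), §9 Thm. 5. [Jozsa2003]
* D. E. Knuth, *The Art of Computer Programming*, Vol. 2, 3rd ed., Addison-Wesley 1998, §4.3.1,
  §4.5.1 (multiple-precision and rational arithmetic); R. P. Brent, *Fast multiple-precision
  evaluation of elementary functions*, J. ACM 23 (1976) 242–251 (the reduction `ln x = s ln 2 + ln t`
  and series evaluation). [KnuthTAOCP2]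
-/

noncomputable section

namespace Literature.Computability.Complexity

open _root_.Computability Finset
open Literature.Algebra.EuclideanLattices (encodeRat)

namespace LogFP

/-! ### The artanh series with exact rational partial sums -/

/-- The term `u^{2k+1}/((2k+1) v^{2k+1})` as a rational. [cite: KnuthTAOCP2, §4.5.1] -/
def artanhTermQ (u v k : ℕ) : ℚ := ((u ^ (2 * k + 1) : ℕ) : ℚ) / (((2 * k + 1) * v ^ (2 * k + 1) : ℕ) : ℚ)

/-- `artanhSum u v K = ∑_{k<K} u^{2k+1}/((2k+1) v^{2k+1})` (a list sum, the shape `ratSum` computes).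
[cite: KnuthTAOCP2, §4.5.1] -/
def artanhSum (u v K : ℕ) : ℚ := ((List.range K).map (artanhTermQ u v)).sum

/-- The real value of a term: `x^{2k+1}/(2k+1)`, `x = u/v`. [folklore] -/
theorem cast_artanhTermQ (u : ℕ) {v : ℕ} (hv : 0 < v) (k : ℕ) :
    (artanhTermQ u v k : ℝ) = ((u : ℝ) / v) ^ (2 * k + 1) / (2 * k + 1) := by
  unfold artanhTermQ
  have hv' : (v : ℝ) ≠ 0 := by exact_mod_cast hv.ne'
  push_cast
  rw [div_pow]
  field_simp

/-- The real value of the partial sum. [folklore] -/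
theorem cast_artanhSum (u : ℕ) {v : ℕ} (hv : 0 < v) (K : ℕ) :
    (artanhSum u v K : ℝ) = ∑ k ∈ range K, ((u : ℝ) / v) ^ (2 * k + 1) / (2 * k + 1) := by
  unfold artanhSum
  rw [Rat.cast_list_sum, List.map_map, ← List.sum_toFinset _ (List.nodup_range),
    List.toFinset_range]
  exact Finset.sum_congr rfl fun k _ => by simp [cast_artanhTermQ u hv k]

/-- `artanhSum ≥ 0`. [folklore] -/
theorem artanhSum_nonneg (u v K : ℕ) : 0 ≤ artanhSum u v K := by
  unfold artanhSum
  apply List.sum_nonneg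
  intro q hq
  rw [List.mem_map] at hq
  obtain ⟨k, -, rfl⟩ := hq
  unfold artanhTermQ
  positivity

/-- **The artanh series, truncated**: for `3u ≤ v` (so `x = u/v ≤ 1/3`),
`|log ((v + u)/(v − u)) − 2 artanhSum u v K| ≤ (1/9)ᴷ`; indeed the truncation error is the
nonnegative tail `∑_{k ≥ K} 2x^{2k+1}/(2k+1) ≤ 2x^{2K+1}/(1 − x²) ≤ (3/4)(1/9)ᴷ`.
[cite: KnuthTAOCP2, §4.3.1 (series evaluation with a truncation bound)] -/
theorem abs_log_sub_two_mul_artanhSum_le {u v : ℕ} (huv : 3 * u ≤ v) (hv : 0 < v) (K : ℕ) :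
    |Real.log (((v : ℝ) + u) / (v - u)) - 2 * (artanhSum u v K : ℝ)| ≤ (1 / 9 : ℝ) ^ K := by
  have hvR : (0 : ℝ) < v := by exact_mod_cast hv
  have huvR : 3 * (u : ℝ) ≤ v := by exact_mod_cast huv
  set x : ℝ := (u : ℝ) / v with hx
  have hx0 : 0 ≤ x := by positivity
  have hx3 : x ≤ 1 / 3 := by rw [hx, div_le_iff₀ hvR]; linarith
  have hx1 : x < 1 := by linarith
  have habs : |x| < 1 := by rw [abs_of_nonneg hx0]; exact hx1
  have hT : Real.log (1 + x) - Real.log (1 - x) = Real.log (((v : ℝ) + u) / (v - u)) := by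
    have hv0 : (v : ℝ) ≠ 0 := hvR.ne'
    have h1 : 1 + x = ((v : ℝ) + u) / v := by rw [hx]; field_simp
    have h2 : 1 - x = ((v : ℝ) - u) / v := by rw [hx]; field_simp
    have hvu : (0 : ℝ) < v - u := by linarith [(show (0:ℝ) ≤ u by positivity)]
    rw [h1, h2, Real.log_div (by positivity) hv0, Real.log_div hvu.ne' hv0,
      Real.log_div (by positivity) hvu.ne']
    ring
  set f : ℕ → ℝ := fun k => (2 : ℝ) * (1 / (2 * k + 1)) * x ^ (2 * k + 1) with hf
  have hsum : HasSum f (Real.log (((v : ℝ) + u) / (v - u))) :=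
    hT ▸ Real.hasSum_log_sub_log_of_abs_lt_one habs
  have hf0 : ∀ k, 0 ≤ f k := fun k => by simp only [hf]; positivity
  have hpartial : ∑ k ∈ range K, f k = 2 * (artanhSum u v K : ℝ) := by
    rw [cast_artanhSum u hv K, mul_sum]
    refine sum_congr rfl fun k _ => ?_
    simp only [hf, hx]; ring
  -- the tail
  have htail : HasSum (fun n => f (n + K)) (Real.log (((v : ℝ) + u) / (v - u)) - ∑ k ∈ range K, f k) :=
    (hasSum_nat_add_iff K).2 (by rwa [sub_add_cancel])
  have htail0 : 0 ≤ Real.log (((v : ℝ) + u) / (v - u)) - ∑ k ∈ range K, f k :=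
    htail.nonneg fun n => hf0 _
  have hx2 : x ^ 2 < 1 := by nlinarith
  set C : ℝ := 2 * x ^ (2 * K + 1) with hC
  have hgeom : HasSum (fun n : ℕ => C * (x ^ 2) ^ n) (C * (1 - x ^ 2)⁻¹) :=
    (hasSum_geometric_of_lt_one (sq_nonneg x) hx2).mul_left C
  have hcmp : ∀ n : ℕ, f (n + K) ≤ C * (x ^ 2) ^ n := by
    intro n
    simp only [hf, hC]
    have h1 : (2 : ℝ) * (1 / (2 * ((n + K : ℕ) : ℝ) + 1)) ≤ 2 := by
      rw [mul_one_div]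
      apply div_le_self (by norm_num)
      have : (0 : ℝ) ≤ ((n + K : ℕ) : ℝ) := by positivity
      linarith
    have h2 : x ^ (2 * (n + K) + 1) = x ^ (2 * K + 1) * (x ^ 2) ^ n := by
      rw [← pow_mul, ← pow_add]; congr 1; ring
    rw [h2, ← mul_assoc]
    apply mul_le_mul_of_nonneg_right _ (by positivity)
    exact mul_le_mul_of_nonneg_right h1 (by positivity)
  have htail_le : Real.log (((v : ℝ) + u) / (v - u)) - ∑ k ∈ range K, f k ≤ C * (1 - x ^ 2)⁻¹ :=
    hasSum_le hcmp htail hgeom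
  -- `C (1 − x²)⁻¹ ≤ (9/8) · 2 · (1/3)^{2K+1} = (3/4) (1/9)^K ≤ (1/9)^K`
  have hgeo_le : C * (1 - x ^ 2)⁻¹ ≤ (1 / 9 : ℝ) ^ K := by
    have h19 : (1 - x ^ 2)⁻¹ ≤ 9 / 8 := by
      rw [inv_le_comm₀ (by nlinarith) (by norm_num)]
      nlinarith
    have hpow : x ^ (2 * K + 1) ≤ (1 / 3 : ℝ) ^ (2 * K + 1) := pow_le_pow_left₀ hx0 hx3 _
    have h13 : (1 / 3 : ℝ) ^ (2 * K + 1) = (1 / 9 : ℝ) ^ K / 3 := by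
      rw [pow_succ, pow_mul, show ((1 : ℝ) / 3) ^ 2 = 1 / 9 by norm_num]; ring
    have h9 : (0 : ℝ) ≤ (1 / 9 : ℝ) ^ K := by positivity
    calc C * (1 - x ^ 2)⁻¹ ≤ (2 * (1 / 3 : ℝ) ^ (2 * K + 1)) * (9 / 8) := by
          apply mul_le_mul _ h19 (by rw [inv_nonneg]; nlinarith) (by positivity)
          rw [hC]; linarith
      _ = (3 / 4) * (1 / 9 : ℝ) ^ K := by rw [h13]; ring
      _ ≤ (1 / 9 : ℝ) ^ K := by linarith
  rw [hpartial] at htail0 htail_le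
  rw [abs_of_nonneg htail0]
  exact htail_le.trans hgeo_le

/-- `ln2Q K = 2 artanhSum 1 3 K ≈ log 2` (`2 = (3 + 1)/(3 − 1)`). [cite: KnuthTAOCP2, §4.3.1] -/
def ln2Q (K : ℕ) : ℚ := 2 * artanhSum 1 3 K

/-- `|log 2 − ln2Q K| ≤ (1/9)ᴷ`. [folklore] -/
theorem abs_log_two_sub_ln2Q_le (K : ℕ) : |Real.log 2 - (ln2Q K : ℝ)| ≤ (1 / 9 : ℝ) ^ K := by
  have h := abs_log_sub_two_mul_artanhSum_le (u := 1) (v := 3) (by norm_num) (by norm_num) K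
  have h2 : (((3 : ℕ) : ℝ) + (1 : ℕ)) / ((3 : ℕ) - (1 : ℕ)) = 2 := by norm_num
  rw [h2] at h
  unfold ln2Q; push_cast
  exact h

/-! ### Argument reduction `a/b = 2ˢ · t`, `t ∈ [1, 2)` -/

/-- The binary shift `s = ⌊log₂ ⌊a/b⌋⌋` with `b 2ˢ ≤ a < b 2^{s+1}` (for `1 ≤ b ≤ a`).
[cite: KnuthTAOCP2, §4.3.1] -/
def logShift (a b : ℕ) : ℕ := Nat.log 2 (a / b)

/-- `b 2ˢ ≤ a < b 2^{s+1}` for `s = logShift a b`, `1 ≤ b ≤ a`. [folklore] -/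
theorem logShift_spec {a b : ℕ} (hb : 1 ≤ b) (hba : b ≤ a) :
    b * 2 ^ logShift a b ≤ a ∧ a < b * 2 ^ (logShift a b + 1) := by
  have hq : 1 ≤ a / b := (Nat.le_div_iff_mul_le hb).2 (by simpa using hba)
  have h1 : 2 ^ logShift a b ≤ a / b := Nat.pow_log_le_self 2 (by omega)
  have h2 : a / b < 2 ^ (logShift a b + 1) := Nat.lt_pow_succ_log_self (by norm_num) _
  constructor
  · calc b * 2 ^ logShift a b ≤ b * (a / b) := Nat.mul_le_mul_left b h1
      _ ≤ a := Nat.mul_div_le a b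
  · rw [Nat.div_lt_iff_lt_mul hb] at h2
    linarith [h2, Nat.mul_comm (2 ^ (logShift a b + 1)) b]

/-- `logShift a b ≤ |a|₂` (the bit length of `a`). [folklore] -/
theorem logShift_le_size (a b : ℕ) : logShift a b ≤ Nat.size a := by
  unfold logShift
  have h1 : Nat.log 2 (a / b) ≤ Nat.log 2 a := Nat.log_mono_right (Nat.div_le_self a b)
  refine h1.trans ?_
  rcases Nat.eq_zero_or_pos a with rfl | ha
  · simp
  · exact (Nat.log_lt_of_lt_pow (Nat.pos_iff_ne_zero.1 ha) (Nat.lt_size_self a)).le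

/-- `lnQ a b K = s · ln2Q K + 2 artanhSum (a − b2ˢ) (a + b2ˢ) K ≈ log (a/b)`, `s = logShift a b`.
[cite: KnuthTAOCP2, §4.3.1] -/
def lnQ (a b K : ℕ) : ℚ :=
  (logShift a b : ℚ) * ln2Q K + 2 * artanhSum (a - b * 2 ^ logShift a b) (a + b * 2 ^ logShift a b) K

/-- **`|log (a/b) − lnQ a b K| ≤ (s + 1)/9ᴷ`** for `1 ≤ b ≤ a`: `log (a/b) = s log 2 + log t`,
`t = a/(b 2ˢ) ∈ [1, 2)`, `log t = log ((v + u)/(v − u))` with `u = a − b2ˢ`, `v = a + b2ˢ`,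
`3u ≤ v`. [cite: KnuthTAOCP2, §4.3.1] -/
theorem abs_log_div_sub_lnQ_le {a b : ℕ} (hb : 1 ≤ b) (hba : b ≤ a) (K : ℕ) :
    |Real.log ((a : ℝ) / b) - (lnQ a b K : ℝ)| ≤ ((logShift a b : ℝ) + 1) * (1 / 9 : ℝ) ^ K := by
  set s := logShift a b with hs
  obtain ⟨h1, h2⟩ := logShift_spec hb hba
  rw [← hs] at h1 h2
  set u := a - b * 2 ^ s with hu
  set v := a + b * 2 ^ s with hv
  have hvpos : 0 < v := by rw [hv]; positivity
  have h2' : a < 2 * (b * 2 ^ s) := by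
    have : b * 2 ^ (s + 1) = 2 * (b * 2 ^ s) := by ring
    omega
  have huv : 3 * u ≤ v := by rw [hu, hv]; omega
  have hbR : (0 : ℝ) < b := by exact_mod_cast hb
  have haR : (0 : ℝ) < a := by exact_mod_cast (lt_of_lt_of_le hb hba)
  have h2s : (0 : ℝ) < (2 : ℝ) ^ s := by positivity
  -- `(v + u)/(v - u) = a / (b 2^s)`
  have huR : (u : ℝ) = a - b * 2 ^ s := by
    rw [hu]; push_cast [Nat.cast_sub h1]; ring
  have hvR : (v : ℝ) = a + b * 2 ^ s := by rw [hv]; push_cast; ring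
  have hratio : ((v : ℝ) + u) / (v - u) = (a : ℝ) / (b * 2 ^ s) := by
    rw [huR, hvR]; field_simp; ring
  have hlogt := abs_log_sub_two_mul_artanhSum_le huv hvpos K
  rw [hratio] at hlogt
  have hlog2 := abs_log_two_sub_ln2Q_le K
  -- `log (a/b) = s log 2 + log (a/(b 2^s))`
  have hsplit : Real.log ((a : ℝ) / b) = s * Real.log 2 + Real.log ((a : ℝ) / (b * 2 ^ s)) := by
    rw [Real.log_div haR.ne' hbR.ne', Real.log_div haR.ne' (by positivity),
      Real.log_mul hbR.ne' h2s.ne', Real.log_pow]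
    ring
  have hcast : (lnQ a b K : ℝ) = s * (ln2Q K : ℝ) + 2 * (artanhSum u v K : ℝ) := by
    rw [lnQ, ← hs]; push_cast; rw [← hu, ← hv]
  rw [hsplit, hcast]
  have hs0 : (0 : ℝ) ≤ s := by positivity
  calc |↑s * Real.log 2 + Real.log (↑a / (↑b * 2 ^ s)) - (↑s * ↑(ln2Q K) + 2 * ↑(artanhSum u v K))|
      = |↑s * (Real.log 2 - ↑(ln2Q K)) + (Real.log (↑a / (↑b * 2 ^ s)) - 2 * ↑(artanhSum u v K))| := by
        ring_nf
    _ ≤ |↑s * (Real.log 2 - ↑(ln2Q K))| + |Real.log (↑a / (↑b * 2 ^ s)) - 2 * ↑(artanhSum u v K)| :=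
        abs_add_le _ _
    _ ≤ s * (1 / 9 : ℝ) ^ K + (1 / 9 : ℝ) ^ K := by
        rw [abs_mul, abs_of_nonneg hs0]
        exact add_le_add (mul_le_mul_of_nonneg_left hlog2 hs0) hlogt
    _ = (↑s + 1) * (1 / 9 : ℝ) ^ K := by ring

/-! ### The dyadic name -/

/-- **`lnDyadic a b p = round (2ᵖ · lnQ a b (p + |a|₂ + 1)) ∈ ℤ`**: `log (a/b)` to `p` bits
(`1 ≤ b ≤ a`). [cite: KnuthTAOCP2, §4.3.1] -/
def lnDyadic (a b p : ℕ) : ℤ := round ((2 : ℚ) ^ p * lnQ a b (p + Nat.size a + 1))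

/-- `(s + 1) (1/9)^{p + |a|₂ + 1} · 2ᵖ ≤ 1/2`. [folklore] -/
theorem shift_err_le {a b : ℕ} (p : ℕ) :
    ((logShift a b : ℝ) + 1) * (1 / 9 : ℝ) ^ (p + Nat.size a + 1) * 2 ^ p ≤ 1 / 2 := by
  have hs : (logShift a b : ℝ) + 1 ≤ 2 ^ Nat.size a := by
    have h1 := logShift_le_size a b
    have h2 : ((logShift a b : ℕ) : ℝ) ≤ Nat.size a := by exact_mod_cast h1
    have h3 : ((Nat.size a : ℕ) : ℝ) + 1 ≤ 2 ^ Nat.size a := by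
      have : Nat.size a + 1 ≤ 2 ^ Nat.size a := Nat.lt_two_pow_self
      exact_mod_cast this
    linarith
  have hpow : (1 / 9 : ℝ) ^ (p + Nat.size a + 1) = (1 / 9) ^ p * (1 / 9) ^ Nat.size a * (1 / 9) := by
    rw [pow_add, pow_add, pow_one]
  rw [hpow]
  have hA : (2 : ℝ) ^ Nat.size a * (1 / 9 : ℝ) ^ Nat.size a ≤ 1 := by
    rw [← mul_pow]; exact pow_le_one₀ (by norm_num) (by norm_num)
  have hB : (1 / 9 : ℝ) ^ p * 2 ^ p ≤ 1 := by
    rw [← mul_pow]; exact pow_le_one₀ (by norm_num) (by norm_num)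
  have h9 : (0 : ℝ) ≤ (1 / 9 : ℝ) ^ p := by positivity
  have h9' : (0 : ℝ) ≤ (1 / 9 : ℝ) ^ Nat.size a := by positivity
  have h2p : (0 : ℝ) ≤ 2 ^ p := by positivity
  calc ((logShift a b : ℝ) + 1) * ((1 / 9) ^ p * (1 / 9) ^ Nat.size a * (1 / 9)) * 2 ^ p
      ≤ 2 ^ Nat.size a * ((1 / 9) ^ p * (1 / 9) ^ Nat.size a * (1 / 9)) * 2 ^ p := by
        apply mul_le_mul_of_nonneg_right _ h2p
        apply mul_le_mul_of_nonneg_right hs (by positivity)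
    _ = (2 ^ Nat.size a * (1 / 9) ^ Nat.size a) * ((1 / 9) ^ p * 2 ^ p) * (1 / 9) := by ring
    _ ≤ 1 * 1 * (1 / 9) := by
        apply mul_le_mul_of_nonneg_right _ (by norm_num)
        exact mul_le_mul hA hB (by positivity) zero_le_one
    _ ≤ 1 / 2 := by norm_num

/-- **`|log (a/b) − lnDyadic a b p / 2ᵖ| ≤ 2⁻ᵖ`** (`1 ≤ b ≤ a`): truncation `≤ 2⁻ᵖ/2` plus
rounding `≤ 2⁻ᵖ/2`. [cite: KnuthTAOCP2, §4.3.1] -/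
theorem abs_log_div_sub_lnDyadic_le {a b : ℕ} (hb : 1 ≤ b) (hba : b ≤ a) (p : ℕ) :
    |Real.log ((a : ℝ) / b) - (lnDyadic a b p : ℝ) / 2 ^ p| ≤ 1 / (2 : ℝ) ^ p := by
  have h2p : (0 : ℝ) < (2 : ℝ) ^ p := by positivity
  have htr := abs_log_div_sub_lnQ_le hb hba (p + Nat.size a + 1)
  have hsh := shift_err_le (a := a) (b := b) p
  have hroundQ : |(2 : ℚ) ^ p * lnQ a b (p + Nat.size a + 1) - (lnDyadic a b p : ℚ)| ≤ 1 / 2 := by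
    unfold lnDyadic; exact abs_sub_round _
  have hroundR : |(2 : ℝ) ^ p * (lnQ a b (p + Nat.size a + 1) : ℝ) - (lnDyadic a b p : ℝ)| ≤ 1 / 2 := by
    have h : ((|(2 : ℚ) ^ p * lnQ a b (p + Nat.size a + 1) - (lnDyadic a b p : ℚ)| : ℚ) : ℝ) ≤
        ((1 / 2 : ℚ) : ℝ) := by exact_mod_cast hroundQ
    push_cast at h
    exact h
  have key : |(2 : ℝ) ^ p * Real.log ((a : ℝ) / b) - (lnDyadic a b p : ℝ)| ≤ 1 := by
    calc |(2 : ℝ) ^ p * Real.log ((a : ℝ) / b) - (lnDyadic a b p : ℝ)|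
        = |(2 : ℝ) ^ p * (Real.log ((a : ℝ) / b) - (lnQ a b (p + Nat.size a + 1) : ℝ)) +
            ((2 : ℝ) ^ p * (lnQ a b (p + Nat.size a + 1) : ℝ) - (lnDyadic a b p : ℝ))| := by ring_nf
      _ ≤ |(2 : ℝ) ^ p * (Real.log ((a : ℝ) / b) - (lnQ a b (p + Nat.size a + 1) : ℝ))| +
            |(2 : ℝ) ^ p * (lnQ a b (p + Nat.size a + 1) : ℝ) - (lnDyadic a b p : ℝ)| := abs_add_le _ _
      _ ≤ 1 / 2 + 1 / 2 := by
          refine add_le_add ?_ hroundR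
          rw [abs_mul, abs_of_pos h2p]
          calc (2 : ℝ) ^ p * |Real.log ((a : ℝ) / b) - (lnQ a b (p + Nat.size a + 1) : ℝ)|
              ≤ 2 ^ p * (((logShift a b : ℝ) + 1) * (1 / 9 : ℝ) ^ (p + Nat.size a + 1)) :=
                mul_le_mul_of_nonneg_left htr h2p.le
            _ ≤ 1 / 2 := by linarith
      _ = 1 := by norm_num
  have hrew : Real.log ((a : ℝ) / b) - (lnDyadic a b p : ℝ) / 2 ^ p =
      ((2 : ℝ) ^ p * Real.log ((a : ℝ) / b) - (lnDyadic a b p : ℝ)) / 2 ^ p := by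
    field_simp
  rw [hrew, abs_div, abs_of_pos h2p]
  exact div_le_div_of_nonneg_right key h2p.le

/-- **The signed logarithm name**: `lnDyadicZ a b p ≈ 2ᵖ log (a/b)` for `a, b ≥ 1` in either order
(junk values outside `a, b ≥ 1`). [cite: KnuthTAOCP2, §4.3.1] -/
def lnDyadicZ (a b p : ℕ) : ℤ := if b ≤ a then lnDyadic a b p else -lnDyadic b a p

/-- **`|log (a/b) − lnDyadicZ a b p / 2ᵖ| ≤ 2⁻ᵖ`** for `a, b ≥ 1`. [cite: KnuthTAOCP2, §4.3.1] -/
theorem abs_log_div_sub_lnDyadicZ_le {a b : ℕ} (ha : 1 ≤ a) (hb : 1 ≤ b) (p : ℕ) :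
    |Real.log ((a : ℝ) / b) - (lnDyadicZ a b p : ℝ) / 2 ^ p| ≤ 1 / (2 : ℝ) ^ p := by
  unfold lnDyadicZ
  split_ifs with h
  · exact abs_log_div_sub_lnDyadic_le hb h p
  · push Not at h
    have h' := abs_log_div_sub_lnDyadic_le ha h.le p
    have haR : (0 : ℝ) < a := by exact_mod_cast ha
    have hbR : (0 : ℝ) < b := by exact_mod_cast hb
    have hlog : Real.log ((a : ℝ) / b) = -Real.log ((b : ℝ) / a) := by
      rw [← Real.log_inv, inv_div]
    rw [hlog, Int.cast_neg, neg_div, ← neg_sub_neg, neg_neg, abs_sub_comm]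
    convert h' using 2
    ring

/-! ### Logarithms of quadratic irrationals `(P + √D)/Q` -/

/-- The scaled integer square root `⌊2ʲ √D⌋ = Nat.sqrt (D · 4ʲ)`. [folklore] -/
def sqrtScaled (D j : ℕ) : ℕ := Nat.sqrt (D * 4 ^ j)

/-- `⌊2ʲ√D⌋ ≤ 2ʲ √D < ⌊2ʲ√D⌋ + 1`. [folklore] -/
theorem sqrtScaled_mem (D j : ℕ) :
    (sqrtScaled D j : ℝ) ≤ 2 ^ j * Real.sqrt D ∧ 2 ^ j * Real.sqrt D < sqrtScaled D j + 1 := by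
  have h : Real.sqrt ((D * 4 ^ j : ℕ) : ℝ) = 2 ^ j * Real.sqrt D := by
    push_cast
    rw [show (4 : ℝ) ^ j = (2 ^ j) ^ 2 by rw [← pow_mul, mul_comm, pow_mul]; norm_num,
      Real.sqrt_mul (Nat.cast_nonneg D), Real.sqrt_sq (by positivity), mul_comm]
  refine ⟨?_, ?_⟩
  · rw [← h]; exact Real.nat_sqrt_le_real_sqrt
  · rw [← h]; exact Real.real_sqrt_lt_nat_sqrt_succ

/-- `2ʲ ≤ ⌊2ʲ√D⌋` for `D ≥ 1`. [folklore] -/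
theorem two_pow_le_sqrtScaled {D : ℕ} (hD : 1 ≤ D) (j : ℕ) : 2 ^ j ≤ sqrtScaled D j := by
  unfold sqrtScaled
  rw [Nat.le_sqrt]
  calc 2 ^ j * 2 ^ j = 1 * 4 ^ j := by rw [← pow_two, ← pow_mul, mul_comm j 2, pow_mul]; norm_num
    _ ≤ D * 4 ^ j := Nat.mul_le_mul_right _ hD

/-- **The dyadic logarithm of a quadratic irrational**: for `γ = (P + √D)/Q` (`P ≥ 0`, `Q, D ≥ 1`),
`lnQuadDyadic P Q D j p = lnDyadicZ (P 2ʲ + ⌊2ʲ√D⌋) (Q 2ʲ) p ≈ 2ᵖ log γ` — the Shanks distance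
`ln γ` of Hallgren's/Jozsa's baby step to `p` bits, `√D` read to `j` bits.
[cite: Jozsa2003, §9 Thm. 5 (δ(I, ρ(I)) = ln |γ| to sufficient accuracy)] -/
def lnQuadDyadic (P Q D j p : ℕ) : ℤ := lnDyadicZ (P * 2 ^ j + sqrtScaled D j) (Q * 2 ^ j) p

/-- **`|log ((P + √D)/Q) − lnQuadDyadic/2ᵖ| ≤ 2⁻ᵖ + 2⁻ʲ`** (`Q, D ≥ 1`): the rational
`(P 2ʲ + ⌊2ʲ√D⌋)/(Q 2ʲ)` is below `γ` by a factor in `[1, 1 + 1/⌊2ʲ√D⌋)`, and `log (1 + t) ≤ t`.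
[cite: Jozsa2003, §9 Thm. 5] -/
theorem abs_log_quad_sub_lnQuadDyadic_le {P Q D : ℕ} (hQ : 1 ≤ Q) (hD : 1 ≤ D) (j p : ℕ) :
    |Real.log (((P : ℝ) + Real.sqrt D) / Q) - (lnQuadDyadic P Q D j p : ℝ) / 2 ^ p| ≤
      1 / (2 : ℝ) ^ p + 1 / (2 : ℝ) ^ j := by
  obtain ⟨hr1, hr2⟩ := sqrtScaled_mem D j
  have hrj : 2 ^ j ≤ sqrtScaled D j := two_pow_le_sqrtScaled hD j
  have h2j : (0 : ℝ) < (2 : ℝ) ^ j := by positivity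
  have hrjR : (2 : ℝ) ^ j ≤ sqrtScaled D j := by exact_mod_cast hrj
  have hQR : (0 : ℝ) < Q := by exact_mod_cast hQ
  have hN1 : 1 ≤ P * 2 ^ j + sqrtScaled D j := by
    have : 1 ≤ 2 ^ j := Nat.one_le_two_pow
    omega
  have hNR : ((P * 2 ^ j + sqrtScaled D j : ℕ) : ℝ) = P * 2 ^ j + sqrtScaled D j := by push_cast; ring
  have hNpos : (0 : ℝ) < ((P * 2 ^ j + sqrtScaled D j : ℕ) : ℝ) := by
    rw [hNR]; linarith [hrjR, h2j, (by positivity : (0 : ℝ) ≤ P * 2 ^ j)]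
  have hden : 1 ≤ Q * 2 ^ j := Nat.one_le_iff_ne_zero.mpr (by positivity)
  have hmain := abs_log_div_sub_lnDyadicZ_le hN1 hden p
  have hdenR : (0 : ℝ) < ((Q * 2 ^ j : ℕ) : ℝ) := by push_cast; positivity
  -- `γ = (N + t)/(Q 2^j)` with `0 ≤ t < 1`
  set t : ℝ := 2 ^ j * Real.sqrt D - sqrtScaled D j with ht
  have ht0 : 0 ≤ t := by rw [ht]; linarith
  have ht1 : t < 1 := by rw [ht]; linarith
  have hγeq : ((P : ℝ) + Real.sqrt D) / Q =
      (((P * 2 ^ j + sqrtScaled D j : ℕ) : ℝ) + t) / ((Q * 2 ^ j : ℕ) : ℝ) := by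
    rw [hNR, ht]; push_cast; field_simp; ring
  have hratio_pos : (0 : ℝ) < ((P * 2 ^ j + sqrtScaled D j : ℕ) : ℝ) / ((Q * 2 ^ j : ℕ) : ℝ) := by
    positivity
  have hγpos : 0 < ((P : ℝ) + Real.sqrt D) / Q := by rw [hγeq]; positivity
  -- `0 ≤ log γ - log (N/(Q 2^j)) ≤ 1/N ≤ 2^{-j}`
  have hdiff : Real.log (((P : ℝ) + Real.sqrt D) / Q) -
      Real.log (((P * 2 ^ j + sqrtScaled D j : ℕ) : ℝ) / ((Q * 2 ^ j : ℕ) : ℝ)) =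
      Real.log (1 + t / ((P * 2 ^ j + sqrtScaled D j : ℕ) : ℝ)) := by
    rw [← Real.log_div hγpos.ne' hratio_pos.ne', hγeq]
    congr 1
    field_simp
  have htN : 0 ≤ t / ((P * 2 ^ j + sqrtScaled D j : ℕ) : ℝ) := by positivity
  have hlo : 0 ≤ Real.log (((P : ℝ) + Real.sqrt D) / Q) -
      Real.log (((P * 2 ^ j + sqrtScaled D j : ℕ) : ℝ) / ((Q * 2 ^ j : ℕ) : ℝ)) := by
    rw [hdiff]; exact Real.log_nonneg (by linarith)
  have hhi : Real.log (((P : ℝ) + Real.sqrt D) / Q) -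
      Real.log (((P * 2 ^ j + sqrtScaled D j : ℕ) : ℝ) / ((Q * 2 ^ j : ℕ) : ℝ)) ≤ 1 / (2 : ℝ) ^ j := by
    rw [hdiff]
    have hpos : 0 < 1 + t / ((P * 2 ^ j + sqrtScaled D j : ℕ) : ℝ) := by linarith
    calc Real.log (1 + t / ((P * 2 ^ j + sqrtScaled D j : ℕ) : ℝ))
        ≤ (1 + t / ((P * 2 ^ j + sqrtScaled D j : ℕ) : ℝ)) - 1 := Real.log_le_sub_one_of_pos hpos
      _ = t / ((P * 2 ^ j + sqrtScaled D j : ℕ) : ℝ) := by ring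
      _ ≤ 1 / ((P * 2 ^ j + sqrtScaled D j : ℕ) : ℝ) := div_le_div_of_nonneg_right ht1.le hNpos.le
      _ ≤ 1 / (2 : ℝ) ^ j := by
          apply one_div_le_one_div_of_le h2j
          rw [hNR]
          have : (0 : ℝ) ≤ P * 2 ^ j := by positivity
          linarith
  -- assemble
  unfold lnQuadDyadic
  calc |Real.log (((P : ℝ) + Real.sqrt D) / Q) -
        ((lnDyadicZ (P * 2 ^ j + sqrtScaled D j) (Q * 2 ^ j) p : ℝ)) / 2 ^ p|
      = |(Real.log (((P : ℝ) + Real.sqrt D) / Q) -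
            Real.log (((P * 2 ^ j + sqrtScaled D j : ℕ) : ℝ) / ((Q * 2 ^ j : ℕ) : ℝ))) +
          (Real.log (((P * 2 ^ j + sqrtScaled D j : ℕ) : ℝ) / ((Q * 2 ^ j : ℕ) : ℝ)) -
            (lnDyadicZ (P * 2 ^ j + sqrtScaled D j) (Q * 2 ^ j) p : ℝ) / 2 ^ p)| := by ring_nf
    _ ≤ |Real.log (((P : ℝ) + Real.sqrt D) / Q) -
            Real.log (((P * 2 ^ j + sqrtScaled D j : ℕ) : ℝ) / ((Q * 2 ^ j : ℕ) : ℝ))| +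
          |Real.log (((P * 2 ^ j + sqrtScaled D j : ℕ) : ℝ) / ((Q * 2 ^ j : ℕ) : ℝ)) -
            (lnDyadicZ (P * 2 ^ j + sqrtScaled D j) (Q * 2 ^ j) p : ℝ) / 2 ^ p| := abs_add_le _ _
    _ ≤ 1 / (2 : ℝ) ^ j + 1 / (2 : ℝ) ^ p := by
        refine add_le_add ?_ hmain
        rw [abs_of_nonneg hlo]; exact hhi
    _ = 1 / (2 : ℝ) ^ p + 1 / (2 : ℝ) ^ j := add_comm _ _

/-! ### Polynomial time -/

section FP

open CodeFP

/-- The size datum in unary: `bin n ↦ 1^{|n|₂}`. (Deliberate two-line duplicate of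
`Literature.Computability.QuantumComplexity.natSizeU_codeFP` (`HidingProgramMachine.lean`) and of
`Khot.unSize` (`Algebra/EuclideanLattices/KhotParamsFP.lean`), both outside this toolkit file's
import closure — a quantum-sampling machine file is not imported into the `CodeFP` toolkit for a
two-line brick.) [folklore] -/
theorem codeFP_unSize : CodeFP natE unE Nat.size :=
  (strLength.comp strOfNat).congr fun n => CodeFP.length_natE n

/-- **The shift `(a, b) ↦ ⌊log₂ ⌊a/b⌋⌋` on codes** (the doubling scan `natLog2Min` with the bit
length of `a` as budget). [cite: KnuthTAOCP2, §4.3.1] -/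
theorem codeFP_logShift : CodeFP (pairE natE natE) natE (fun p => logShift p.1 p.2) := by
  have hbud : CodeFP (pairE natE natE) (rawE unitE) (fun p => List.replicate (Nat.size p.1) ()) :=
    (replicateUnit.comp (codeFP_unSize.comp (fst _ _)) :)
  refine ((natLog2Min.comp (natDiv.pair hbud)).congr fun p => ?_)
  simp only [List.length_replicate]
  exact min_eq_right (logShift_le_size p.1 p.2)

/-- **The term map is polynomial time**: `((u, v, 1ᴮ), bin k) ↦ u^e/((2k+1) v^e)` with the
exponent `e = min (2k+1) B` capped at the unary budget (no cap takes effect when `2k + 1 ≤ B`).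
[cite: KnuthTAOCP2, §4.5.1] -/
theorem codeFP_termCapped :
    CodeFP (pairE (pairE natE (pairE natE unE)) natE) encodeRat
      (fun p => (((p.1.1 ^ (min (2 * p.2 + 1) p.1.2.2) : ℕ) : ℤ) : ℚ) /
        (((2 * p.2 + 1) * p.1.2.1 ^ (min (2 * p.2 + 1) p.1.2.2) : ℕ) : ℚ)) := by
  have hk : CodeFP (pairE (pairE natE (pairE natE unE)) natE) natE (fun p => p.2) := snd _ _
  have hu : CodeFP (pairE (pairE natE (pairE natE unE)) natE) natE (fun p => p.1.1) := (fst _ _).fst'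
  have hv : CodeFP (pairE (pairE natE (pairE natE unE)) natE) natE (fun p => p.1.2.1) :=
    (fst _ _).snd'.fst'
  have hB : CodeFP (pairE (pairE natE (pairE natE unE)) natE) unE (fun p => p.1.2.2) :=
    (fst _ _).snd'.snd'
  have he : CodeFP (pairE (pairE natE (pairE natE unE)) natE) natE (fun p => 2 * p.2 + 1) :=
    (natAdd.comp ((natMul.comp ((const _ 2).pair hk)).pair (const _ 1)) :)
  have heu : CodeFP (pairE (pairE natE (pairE natE unE)) natE) unE (fun p => min (2 * p.2 + 1) p.1.2.2) :=
    (unOfNatMin.comp (hB.pair he) :)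
  have hpu : CodeFP (pairE (pairE natE (pairE natE unE)) natE) natE
      (fun p => p.1.1 ^ (min (2 * p.2 + 1) p.1.2.2)) := (natPow.comp (hu.pair heu) :)
  have hpv : CodeFP (pairE (pairE natE (pairE natE unE)) natE) natE
      (fun p => p.1.2.1 ^ (min (2 * p.2 + 1) p.1.2.2)) := (natPow.comp (hv.pair heu) :)
  have hden : CodeFP (pairE (pairE natE (pairE natE unE)) natE) natE
      (fun p => (2 * p.2 + 1) * p.1.2.1 ^ (min (2 * p.2 + 1) p.1.2.2)) := (natMul.comp (he.pair hpv) :)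
  have hnum : CodeFP (pairE (pairE natE (pairE natE unE)) natE) intE
      (fun p => ((p.1.1 ^ (min (2 * p.2 + 1) p.1.2.2) : ℕ) : ℤ)) := (intOfNat.comp hpu :)
  exact (ratOfIntNat.comp (hnum.pair hden)).congr fun _ => rfl

/-- **`(bin u, bin v, 1ᴷ) ↦ artanhSum u v K` is polynomial time** (a bounded `map` of the terms over
`[0, K)` with budget `2K + 1`, then the exact sum `ratSum`). [cite: KnuthTAOCP2, §4.5.1] -/
theorem codeFP_artanhSum : CodeFP (pairE natE (pairE natE unE)) encodeRat (fun p => artanhSum p.1 p.2.1 p.2.2) := by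
  have hK : CodeFP (pairE natE (pairE natE unE)) unE (fun p => p.2.2) := (snd _ _).snd'
  have hBud : CodeFP (pairE natE (pairE natE unE)) unE (fun p => 2 * p.2.2 + 1) :=
    (unSucc.comp (unAdd.comp (hK.pair hK))).congr fun p => by simp; ring
  have hctx : CodeFP (pairE natE (pairE natE unE)) (pairE natE (pairE natE unE))
      (fun p => (p.1, p.2.1, 2 * p.2.2 + 1)) := (fst _ _).pair ((snd _ _).fst'.pair hBud)
  have hitems : CodeFP (pairE natE (pairE natE unE)) (rawE natE) (fun p => List.range p.2.2) :=
    (urange.comp hK :)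
  have hmap := (map codeFP_termCapped).comp (hctx.pair hitems)
  refine ((ratSum.comp hmap).congr fun p => ?_)
  unfold artanhSum
  congr 1
  refine List.map_congr_left fun k hk => ?_
  rw [List.mem_range] at hk
  unfold artanhTermQ
  simp only
  rw [min_eq_left (by omega)]
  push_cast
  rfl

/-- `ln2Q` on codes: `1ᴷ ↦ ln2Q K`. [cite: KnuthTAOCP2, §4.5.1] -/
theorem codeFP_ln2Q : CodeFP unE encodeRat ln2Q :=
  (ratMul.comp ((const _ (2 : ℚ)).pair (codeFP_artanhSum.comp ((const _ 1).pair ((const _ 3).pair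
    (CodeFP.id unE)))))).congr fun _ => rfl

/-- **`(bin a, bin b, 1ᴷ) ↦ lnQ a b K` is polynomial time** (the shift `s ≤ |a|₂` in unary as the
exponent of `2ˢ`, two artanh sums, exact rational arithmetic). [cite: KnuthTAOCP2, §4.3.1] -/
theorem codeFP_lnQ : CodeFP (pairE natE (pairE natE unE)) encodeRat (fun p => lnQ p.1 p.2.1 p.2.2) := by
  have ha : CodeFP (pairE natE (pairE natE unE)) natE (fun p => p.1) := fst _ _
  have hb : CodeFP (pairE natE (pairE natE unE)) natE (fun p => p.2.1) := (snd _ _).fst'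
  have hK : CodeFP (pairE natE (pairE natE unE)) unE (fun p => p.2.2) := (snd _ _).snd'
  have hs : CodeFP (pairE natE (pairE natE unE)) natE (fun p => logShift p.1 p.2.1) :=
    (codeFP_logShift.comp (ha.pair hb) :)
  -- `s` in unary, capped by `|a|₂` (no cap takes effect)
  have hsu : CodeFP (pairE natE (pairE natE unE)) unE (fun p => logShift p.1 p.2.1) :=
    (unOfNatMin.comp ((codeFP_unSize.comp ha).pair hs)).congr fun p => min_eq_left (logShift_le_size _ _)
  have hpow : CodeFP (pairE natE (pairE natE unE)) natE (fun p => 2 ^ logShift p.1 p.2.1) :=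
    (natPow.comp ((const _ 2).pair hsu) :)
  have hbpow : CodeFP (pairE natE (pairE natE unE)) natE (fun p => p.2.1 * 2 ^ logShift p.1 p.2.1) :=
    (natMul.comp (hb.pair hpow) :)
  have hu : CodeFP (pairE natE (pairE natE unE)) natE (fun p => p.1 - p.2.1 * 2 ^ logShift p.1 p.2.1) :=
    (natSub.comp (ha.pair hbpow) :)
  have hv : CodeFP (pairE natE (pairE natE unE)) natE (fun p => p.1 + p.2.1 * 2 ^ logShift p.1 p.2.1) :=
    (natAdd.comp (ha.pair hbpow) :)
  have hA1 : CodeFP (pairE natE (pairE natE unE)) encodeRat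
      (fun p => artanhSum (p.1 - p.2.1 * 2 ^ logShift p.1 p.2.1) (p.1 + p.2.1 * 2 ^ logShift p.1 p.2.1) p.2.2) :=
    (codeFP_artanhSum.comp (hu.pair (hv.pair hK)) :)
  have hA2 : CodeFP (pairE natE (pairE natE unE)) encodeRat (fun p => ln2Q p.2.2) := (codeFP_ln2Q.comp hK :)
  have hsQ : CodeFP (pairE natE (pairE natE unE)) encodeRat (fun p => (logShift p.1 p.2.1 : ℚ)) :=
    (ratOfIntNat.comp ((intOfNat.comp hs).pair (const _ 1))).congr fun p => by simp
  exact (ratAdd.comp ((ratMul.comp (hsQ.pair hA2)).pair (ratMul.comp ((const _ (2 : ℚ)).pair hA1)))).congr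
    fun p => rfl

/-- **`(bin a, bin b, 1ᵖ) ↦ intE (lnDyadic a b p)` is polynomial time.** [cite: KnuthTAOCP2, §4.3.1] -/
theorem codeFP_lnDyadic : CodeFP (pairE natE (pairE natE unE)) intE (fun p => lnDyadic p.1 p.2.1 p.2.2) := by
  have ha : CodeFP (pairE natE (pairE natE unE)) natE (fun p => p.1) := fst _ _
  have hb : CodeFP (pairE natE (pairE natE unE)) natE (fun p => p.2.1) := (snd _ _).fst'
  have hp : CodeFP (pairE natE (pairE natE unE)) unE (fun p => p.2.2) := (snd _ _).snd'
  have hK : CodeFP (pairE natE (pairE natE unE)) unE (fun p => p.2.2 + Nat.size p.1 + 1) :=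
    (unSucc.comp (unAdd.comp (hp.pair (codeFP_unSize.comp ha)))).congr fun p => by simp
  have hln : CodeFP (pairE natE (pairE natE unE)) encodeRat (fun p => lnQ p.1 p.2.1 (p.2.2 + Nat.size p.1 + 1)) :=
    (codeFP_lnQ.comp (ha.pair (hb.pair hK)) :)
  have h2p : CodeFP (pairE natE (pairE natE unE)) encodeRat (fun p => ((((2 : ℕ) ^ p.2.2 : ℕ) : ℤ) : ℚ) / ((1 : ℕ) : ℚ)) :=
    (ratOfIntNat.comp ((intOfNat.comp (natPow.comp ((const _ 2).pair hp))).pair (const _ 1)) :)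
  refine ((ratRound.comp (ratMul.comp (h2p.pair hln))).congr fun p => ?_)
  unfold lnDyadic
  congr 1
  push_cast
  ring

/-- **`(bin a, bin b, 1ᵖ) ↦ intE (lnDyadicZ a b p)` is polynomial time.** [cite: KnuthTAOCP2, §4.3.1] -/
theorem codeFP_lnDyadicZ : CodeFP (pairE natE (pairE natE unE)) intE (fun p => lnDyadicZ p.1 p.2.1 p.2.2) := by
  have ha : CodeFP (pairE natE (pairE natE unE)) natE (fun p => p.1) := fst _ _
  have hb : CodeFP (pairE natE (pairE natE unE)) natE (fun p => p.2.1) := (snd _ _).fst'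
  have hp : CodeFP (pairE natE (pairE natE unE)) unE (fun p => p.2.2) := (snd _ _).snd'
  have hle : CodeFP (pairE natE (pairE natE unE)) bitE (fun p => decide (p.2.1 ≤ p.1)) :=
    (natLe.comp (hb.pair ha) :)
  have hpos : CodeFP (pairE natE (pairE natE unE)) intE (fun p => lnDyadic p.1 p.2.1 p.2.2) := codeFP_lnDyadic
  have hneg : CodeFP (pairE natE (pairE natE unE)) intE (fun p => -lnDyadic p.2.1 p.1 p.2.2) :=
    (intNeg.comp (codeFP_lnDyadic.comp (hb.pair (ha.pair hp))) :)
  refine ((hle.ite hpos hneg).congr fun p => ?_)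
  unfold lnDyadicZ
  by_cases h : p.2.1 ≤ p.1 <;> simp [h]

/-- **`(bin P, bin Q, bin D, 1ʲ, 1ᵖ) ↦ intE (lnQuadDyadic P Q D j p)` is polynomial time**
(`natSqrt` of `D · 4ʲ`, then `codeFP_lnDyadicZ`). [cite: Jozsa2003, §9 Thm. 5] -/
theorem codeFP_lnQuadDyadic :
    CodeFP (pairE natE (pairE natE (pairE natE (pairE unE unE)))) intE
      (fun p => lnQuadDyadic p.1 p.2.1 p.2.2.1 p.2.2.2.1 p.2.2.2.2) := by
  have hP : CodeFP (pairE natE (pairE natE (pairE natE (pairE unE unE)))) natE (fun p => p.1) := fst _ _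
  have hQ : CodeFP (pairE natE (pairE natE (pairE natE (pairE unE unE)))) natE (fun p => p.2.1) := (snd _ _).fst'
  have hD : CodeFP (pairE natE (pairE natE (pairE natE (pairE unE unE)))) natE (fun p => p.2.2.1) :=
    (snd _ _).snd'.fst'
  have hj : CodeFP (pairE natE (pairE natE (pairE natE (pairE unE unE)))) unE (fun p => p.2.2.2.1) :=
    (snd _ _).snd'.snd'.fst'
  have hp : CodeFP (pairE natE (pairE natE (pairE natE (pairE unE unE)))) unE (fun p => p.2.2.2.2) :=
    (snd _ _).snd'.snd'.snd'
  have h2j : CodeFP (pairE natE (pairE natE (pairE natE (pairE unE unE)))) natE (fun p => 2 ^ p.2.2.2.1) :=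
    (natPow.comp ((const _ 2).pair hj) :)
  have h4j : CodeFP (pairE natE (pairE natE (pairE natE (pairE unE unE)))) natE (fun p => 4 ^ p.2.2.2.1) :=
    (natPow.comp ((const _ 4).pair hj) :)
  have hr : CodeFP (pairE natE (pairE natE (pairE natE (pairE unE unE)))) natE
      (fun p => sqrtScaled p.2.2.1 p.2.2.2.1) := (natSqrt.comp (natMul.comp (hD.pair h4j)) :)
  have hnum : CodeFP (pairE natE (pairE natE (pairE natE (pairE unE unE)))) natE
      (fun p => p.1 * 2 ^ p.2.2.2.1 + sqrtScaled p.2.2.1 p.2.2.2.1) :=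
    (natAdd.comp ((natMul.comp (hP.pair h2j)).pair hr) :)
  have hden : CodeFP (pairE natE (pairE natE (pairE natE (pairE unE unE)))) natE
      (fun p => p.2.1 * 2 ^ p.2.2.2.1) := (natMul.comp (hQ.pair h2j) :)
  exact (codeFP_lnDyadicZ.comp (hnum.pair (hden.pair hp))).congr fun _ => rfl

end FP

end LogFP

end Literature.Computability.Complexity

end
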